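import Summits.BirchSwinnertonDyer.BirchSwinnertonDyer.Theses.SelmerRank
import Summits.BirchSwinnertonDyer.BirchSwinnertonDyer.Theorems.SelmerRankSelmerRankLBStubHeegnerFieldSupply
import Summits.BirchSwinnertonDyer.BirchSwinnertonDyer.Theorems.SelmerRankSelmerRankLBStubTwistCorankEq
import Summits.BirchSwinnertonDyer.BirchSwinnertonDyer.Theorems.SelmerRankSelmerRankLBStubHeegnerBottomTorsion
import Summits.BirchSwinnertonDyer.BirchSwinnertonDyer.Theorems.SelmerRankSelmerRankLBStubKolyvaginStructure
import HarnessLib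

/-!
# Crux `SelmerRankLB` (stmt-BirchSwinnertonDyer-0131), line `heegner_order` — the crux is EQUIVALENT to the Heegner-gap vanishing HV, modulo named literature facts

Continuation lead of the line (`prover-line-stmt-BirchSwinnertonDyer-0131-c1-0`, cycle 1, 2026-08-17).
The skeleton `Cruxes/SelmerRankLB/Lines/heegner_order.lean` proves
`HeegnerOrder.SelmerRankLB_of : HK → HT → HG → HZ → HV → SelmerRank.SelmerRankLB` (sorry-free
composition). After wave 1 the four closable stubs are CLOSED MODULO NAMED FACTS by landed theorems:

* HK `stub_heegner_field_supply_of_facts` (p166035) modulo `exists_isNewformOf` (modularity),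
  `HoffsteinLuo1997_exists_twist_L_one_ne_zero` (central-value twist supply, `w(E) = −1`) and
  `bumpFriedbergHoffstein_exists_heegnerField_split_twist_simpleZero` (derivative twist supply with
  local conditions, `w(E) = +1`);
* HT `stub_twist_corank_eq_of_facts` (p163815) modulo `rank_eq_analyticRank_of_analyticRank_le_one`
  (Gross–Zagier–Kolyvagin);
* HG `stub_heegner_bottom_torsion_of_facts` (p164954) modulo `analyticRankEK_eq_add`,
  `analyticRankEK_eq_one_iff_heegner_nonTorsion` (Gross–Zagier) and
  `heegnerPointOfConductor_one_galoisConj` (Shimura reciprocity at conductor `1`: `P(1) = y_K`);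
* HZ `stub_kolyvagin_structure_of_facts` (p165247) modulo
  `BurungaleEtAl2026_exists_kolyvaginClass_ne_zero` (Kolyvagin's non-vanishing, BCGS 2026 Thm. 1)
  and `Kolyvagin1991_selmerCorank_of_kolyvaginClass_ne_zero` (Kolyvagin 1991 Thm. 4, structure).

HV `stub_heegner_gap` — for `1 ≤ ν(n) ≤ r_an − 3`, `ν(n) ≡ r_an + 1 (mod 2)`, the derived class
`c_M(n)` vanishes — is the OPEN core (first instance `(r_an, ν) = (4, 1)`: the single derived point
`P(ℓ) = Σ_{σ∈S} σ D_ℓ y(ℓ)` is `p^M`-divisible in `E(K[ℓ])` at every Kolyvagin prime `ℓ`).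

This file records, kernel-checked, what the line has achieved: **modulo the ten named literature
facts above, the crux `SelmerRankLB` and the single open statement HV are EQUIVALENT, and the
known range `r_an ≤ 3` of the crux needs NO open input along this line.**

* `selmerRankLB_of_heegnerGap_of_facts` : the ten facts → HV → `SelmerRank.SelmerRankLB` (the
  skeleton's composition with the landed closures plugged in; HV is written out literally as a
  `Prop` hypothesis — it is the registered stub `stub_heegner_gap`, not a named fact, and no `def`
  is minted for it);
* `heegnerGap_of_selmerRankLB_of_facts` : `Kolyvagin1991_selmerCorank_of_kolyvaginClass_ne_zero` →
  `SelmerRank.SelmerRankLB` → HV (the converse: a non-zero class at depth `ν(n) ≤ r_an − 3`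
  gives, at a depth-minimal non-zero class `ν₀ ≤ ν(n)` of the same system, `corank ≤ ν₀ + 1 ≤
  r_an − 2` by Kolyvagin's structure theorem, contradicting `r_an ≤ corank`);
* `selmerRankLB_of_facts_of_analyticRank_le_three_heegner` : the ten facts → the crux on the range
  `ord_{s=1} L(E, s) ≤ 3` with NO open hypothesis (HV is vacuous there: `1 ≤ ν ≤ r_an − 3` is
  empty) — the Heegner side recovers the known range from Gross–Zagier + Kolyvagin's non-vanishing
  and structure theorem + twist supply, WITHOUT the `p`-parity theorem and WITHOUT the corank-1
  `p`-converse that the Kato-side line `kurihara_order` consumes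
  (`selmerRankLB_of_facts_of_analyticRank_le_three`).

So the line has no slack: HV is exactly as hard as the crux from `r_an = 4` on, with every
algebraic and analytic ingredient discharged into theorems in print. All theorems here are
CONDITIONAL (`--supports` helpers); none closes the item.
-/

set_option linter.dupNamespace false

noncomputable section

namespace Summit.BirchSwinnertonDyer.BirchSwinnertonDyer.Theorems

open scoped Classical
open Literature.NumberTheory.EllipticCurves Literature.NumberTheory.EllipticCurves.ModularForms
  WeierstrassCurve
open Summit.BirchSwinnertonDyer.BirchSwinnertonDyer.Theses

/-- A square-free natural number without prime factors is `1`. [folklore] -/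
theorem heegnerGap_eq_one_of_card_primeFactors_eq_zero {n : ℕ} (hsq : Squarefree n)
    (h0 : n.primeFactors.card = 0) : n = 1 := by
  rw [Finset.card_eq_zero, Nat.primeFactors_eq_empty] at h0
  rcases h0 with rfl | rfl
  · exact absurd hsq not_squarefree_zero
  · rfl

/-- **The crux modulo named literature facts and the open stub HV.** Hypotheses, in order:
modularity `exists_isNewformOf`; the twist supplies `HoffsteinLuo1997_exists_twist_L_one_ne_zero`
and `bumpFriedbergHoffstein_exists_heegnerField_split_twist_simpleZero` (HK);
`rank_eq_analyticRank_of_analyticRank_le_one` (HT: Gross–Zagier–Kolyvagin for the twist);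
`analyticRankEK_eq_add`, `analyticRankEK_eq_one_iff_heegner_nonTorsion`,
`heegnerPointOfConductor_one_galoisConj` (HG: the bottom class is the Kummer image of the torsion
point `y_K`); `BurungaleEtAl2026_exists_kolyvaginClass_ne_zero` and
`Kolyvagin1991_selmerCorank_of_kolyvaginClass_ne_zero` (HZ: non-vanishing and structure of the
Heegner Kolyvagin system); and the OPEN Heegner-gap vanishing HV, written out literally (it is the
registered stub `stub_heegner_gap` of the line, first open instance `(r_an, ν(n)) = (4, 1)`).
Consequent: the crux `SelmerRank.SelmerRankLB` by name. Proof (the skeleton's `SelmerRankLB_of`):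
if `corank_p < r_an`, take `K` from HK; HZ gives a non-zero class at depth `ν = max(c, c') − 1` with
`ν + min(c, c')` even, `c' = r' ≤ 1` by HT; `ν = 0` contradicts HG (`r + r' ≥ 2`), and `ν ≥ 1`
forces `c = ν + 1 ≡ r (mod 2)`, so `ν ≤ r − 3` and HV kills the class. CONDITIONAL; credits
nothing to the item. [cite: Kolyvagin1991MathAnn, §2 Thm. 4] [cite: WZhang2014, Thm. 1.2 (p. 195)] -/
theorem selmerRankLB_of_heegnerGap_of_facts :
    exists_isNewformOf → HoffsteinLuo1997_exists_twist_L_one_ne_zero →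
    bumpFriedbergHoffstein_exists_heegnerField_split_twist_simpleZero →
    rank_eq_analyticRank_of_analyticRank_le_one →
    (∀ (W : WeierstrassCurve ℚ) (K : Type) [Field K] [NumberField K], analyticRankEK_eq_add W K) →
    (∀ (W : WeierstrassCurve ℚ) (N : ℕ) [NeZero N] (K : Type) [Field K] [NumberField K],
        analyticRankEK_eq_one_iff_heegner_nonTorsion W N K) →
    (∀ (N : ℕ) [NeZero N] (W : WeierstrassCurve ℚ) (K : Type) [Field K] [NumberField K],
        heegnerPointOfConductor_one_galoisConj N W K) →
    BurungaleEtAl2026_exists_kolyvaginClass_ne_zero →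
    Kolyvagin1991_selmerCorank_of_kolyvaginClass_ne_zero →
    (∀ (W : WeierstrassCurve ℚ) [W.IsElliptic] [W.IsGloballyMinimal] (p : ℕ) [hp : Fact p.Prime],
      5 ≤ p → W.HasGoodReductionAtPrime p → ¬ (p : ℤ) ∣ W.frobeniusTrace p →
      W.HasSurjectiveModNGaloisRep p →
      ∀ (K : Type) [Field K] [NumberField K], IsImaginaryQuadratic K →
        NumberField.discr K ≠ -3 → NumberField.discr K ≠ -4 → ¬ ((p : ℤ) ∣ NumberField.discr K) →
        ∀ [NeZero (W.conductorNorm ℤ)], SatisfiesHeegnerHypothesis (W.conductorNorm ℤ) K →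
        Odd (NumberField.discr K) → SatisfiesHeegnerHypothesis p K →
        (W.quadraticTwist (NumberField.discr K : ℚ)).analyticRank ≤ 1 →
        Odd (W.analyticRank + (W.quadraticTwist (NumberField.discr K : ℚ)).analyticRank) →
        ∀ (Dt : ModularParametrizationData W (W.conductorNorm ℤ)) (β : ℤ) (ι : K →+* ℂ) (n : ℕ)
          (d : KolyvaginHeegnerData Dt β ι n) (M : ℕ),
          Squarefree n → (∀ ℓ ∈ n.primeFactors, Zhang2014.IsKolyvaginPrime (W.conductorNorm ℤ) W K p ℓ) →
          1 ≤ M → (M : ℕ∞) ≤ Zhang2014.levelIndex W p n →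
          1 ≤ n.primeFactors.card → n.primeFactors.card + 3 ≤ W.analyticRank →
          Even (n.primeFactors.card + W.analyticRank + 1) →
          d.kolyvaginClass hp.out M = 0) →
    SelmerRank.SelmerRankLB := by
  intro hmod hHL hBFH hGZK hadd hGZ hrec hA hB hHV W _ _ p hp h5 hgood hord hsurj
  by_contra hlt
  push Not at hlt
  haveI : NeZero (W.conductorNorm ℤ) := ⟨(W.conductorNorm_pos_holds).ne'⟩
  obtain ⟨K, iF, iN, hK, h3, h4, hpd, hH, hdo, hps, hr'le, hodd⟩ :=
    stub_heegner_field_supply_of_facts hmod hHL hBFH W p h5 hgood hord hsurj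
  -- the twist's corank is its analytic rank `r' ≤ 1`
  have hc' : (W.quadraticTwist (NumberField.discr K : ℚ)).selmerCorank p =
      (W.quadraticTwist (NumberField.discr K : ℚ)).analyticRank :=
    stub_twist_corank_eq_of_facts hGZK W p h5 hgood hord hsurj K hK h3 h4 hpd hH hr'le
  -- non-vanishing + structure: a non-zero class at depth `max(c,c') - 1`
  obtain ⟨Dt, β, ι, n, d, M, hsq, hkoly, hM1, hMle, hne, hmax, hpar⟩ :=
    stub_kolyvagin_structure_of_facts hA hB W p h5 hgood hord hsurj K hK h3 h4 hpd hH hdo hps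
  have hk : (W.analyticRank + (W.quadraticTwist (NumberField.discr K : ℚ)).analyticRank) % 2 = 1 :=
    Nat.odd_iff.mp hodd
  have hj : (n.primeFactors.card + min (W.selmerCorank p)
      ((W.quadraticTwist (NumberField.discr K : ℚ)).selmerCorank p)) % 2 = 0 :=
    Nat.even_iff.mp hpar
  rcases Nat.eq_zero_or_pos n.primeFactors.card with hν0 | hν1
  · -- depth 0: `n = 1`, and the bottom class must vanish by Gross–Zagier
    have hn1 : n = 1 := heegnerGap_eq_one_of_card_primeFactors_eq_zero hsq hν0
    subst hn1
    have h2 : 2 ≤ W.analyticRank + (W.quadraticTwist (NumberField.discr K : ℚ)).analyticRank := by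
      rcases le_total (W.selmerCorank p) ((W.quadraticTwist (NumberField.discr K : ℚ)).selmerCorank p)
        with hcc | hcc
      · rw [max_eq_right hcc] at hmax; omega
      · rw [max_eq_left hcc] at hmax; omega
    exact hne (stub_heegner_bottom_torsion_of_facts hadd hGZ hrec W p h5 hgood hord hsurj K hK h3 h4
      hpd hH h2 Dt β ι d M)
  · -- depth ≥ 1: the class lies in the range killed by the Heegner gap
    rcases le_total (W.selmerCorank p) ((W.quadraticTwist (NumberField.discr K : ℚ)).selmerCorank p)
      with hcc | hcc
    · -- `max = c' = r' ≤ 1` forces `ν = 0`: impossible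
      rw [max_eq_right hcc] at hmax
      omega
    · rw [max_eq_left hcc] at hmax
      rw [min_eq_right hcc] at hj
      have hν3 : n.primeFactors.card + 3 ≤ W.analyticRank := by omega
      have hev : Even (n.primeFactors.card + W.analyticRank + 1) := Nat.even_iff.mpr (by omega)
      exact hne (hHV W p h5 hgood hord hsurj K hK h3 h4 hpd hH hdo hps hr'le hodd Dt β ι n d M hsq
        hkoly hM1 hMle hν1 hν3 hev)

/-- **Conversely, the crux implies HV modulo Kolyvagin's structure theorem alone.** At the crux's
primes, for `K` imaginary quadratic with `d_K ∉ {−3, −4}`, `p ∤ d_K` and the Heegner hypothesis, a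
NON-ZERO class `c_M(n) ≠ 0` (`n` a square-free product of Kolyvagin primes, `1 ≤ M ≤ M(n)`) at depth
`ν(n) ≤ r_an − 3` is impossible given `r_an ≤ corank_p` (the crux): minimise the depth over the
non-zero classes of the same system `(Dt, β, ι)` (`Nat.find`; the given class shows the set is
non-empty), `ν₀ ≤ ν(n)`; Kolyvagin 1991 Thm. 4
(`Kolyvagin1991_selmerCorank_of_kolyvaginClass_ne_zero`, `p ∤ N_E` from good reduction at `p`)
gives `c := corank_p Sel_{p^∞}(E/ℚ) = ν₀ + 1` or `c ≤ ν₀`, so `c ≤ ν(n) + 1 ≤ r_an − 2 < r_an ≤ c`.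
The side conditions `Odd d_K`, `p` split, `r' ≤ 1`, parity, `1 ≤ ν(n)` of HV are not used.
Together with `selmerRankLB_of_heegnerGap_of_facts`: modulo the ten named facts the crux and HV
are equivalent — the line isolates the open content exactly, with no slack. CONDITIONAL.
[cite: Kolyvagin1991MathAnn, §2 Thm. 4] [cite: WZhang2014, Thm. 11.2 (i) (p. 248)] -/
theorem heegnerGap_of_selmerRankLB_of_facts :
    Kolyvagin1991_selmerCorank_of_kolyvaginClass_ne_zero → SelmerRank.SelmerRankLB →
    ∀ (W : WeierstrassCurve ℚ) [W.IsElliptic] [W.IsGloballyMinimal] (p : ℕ) [hp : Fact p.Prime],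
      5 ≤ p → W.HasGoodReductionAtPrime p → ¬ (p : ℤ) ∣ W.frobeniusTrace p →
      W.HasSurjectiveModNGaloisRep p →
      ∀ (K : Type) [Field K] [NumberField K], IsImaginaryQuadratic K →
        NumberField.discr K ≠ -3 → NumberField.discr K ≠ -4 → ¬ ((p : ℤ) ∣ NumberField.discr K) →
        ∀ [NeZero (W.conductorNorm ℤ)], SatisfiesHeegnerHypothesis (W.conductorNorm ℤ) K →
        Odd (NumberField.discr K) → SatisfiesHeegnerHypothesis p K →
        (W.quadraticTwist (NumberField.discr K : ℚ)).analyticRank ≤ 1 →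
        Odd (W.analyticRank + (W.quadraticTwist (NumberField.discr K : ℚ)).analyticRank) →
        ∀ (Dt : ModularParametrizationData W (W.conductorNorm ℤ)) (β : ℤ) (ι : K →+* ℂ) (n : ℕ)
          (d : KolyvaginHeegnerData Dt β ι n) (M : ℕ),
          Squarefree n → (∀ ℓ ∈ n.primeFactors, Zhang2014.IsKolyvaginPrime (W.conductorNorm ℤ) W K p ℓ) →
          1 ≤ M → (M : ℕ∞) ≤ Zhang2014.levelIndex W p n →
          1 ≤ n.primeFactors.card → n.primeFactors.card + 3 ≤ W.analyticRank →
          Even (n.primeFactors.card + W.analyticRank + 1) →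
          d.kolyvaginClass hp.out M = 0 := by
  intro hB hLB W _ _ p hp h5 hgood hord hsurj K _ _ hK h3 h4 hpd _ hH _ _ _ _ Dt β ι n d M hsq hkoly
    hM1 hMle _ hν3 _
  by_contra hne
  have hcrux : W.analyticRank ≤ W.selmerCorank p := hLB W p h5 hgood hord hsurj
  have hpN : ¬ (p ∣ W.conductorNorm ℤ) := fun h ↦
    (W.dvd_conductorNorm_iff_not_hasGoodReductionAtPrime p).mp h hgood
  -- minimise the depth over the non-zero classes of the system `(Dt, β, ι)`
  have hex : ∃ k, ∃ (n' : ℕ) (d' : KolyvaginHeegnerData Dt β ι n') (M' : ℕ),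
      KolyvaginDescent.KolSupp (Zhang2014.IsKolyvaginPrime (W.conductorNorm ℤ) W K p) n' ∧
        1 ≤ M' ∧ (M' : ℕ∞) ≤ Zhang2014.levelIndex W p n' ∧ d'.kolyvaginClass hp.out M' ≠ 0 ∧
        n'.primeFactors.card = k :=
    ⟨_, n, d, M, ⟨hsq, hkoly⟩, hM1, hMle, hne, rfl⟩
  obtain ⟨n₀, d₀, M₀, hΛ₀, hM₀, hM₀le, hne₀, hcard₀⟩ := Nat.find_spec hex
  have hmin : ∀ (n' : ℕ) (d' : KolyvaginHeegnerData Dt β ι n') (M' : ℕ),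
      KolyvaginDescent.KolSupp (Zhang2014.IsKolyvaginPrime (W.conductorNorm ℤ) W K p) n' →
      1 ≤ M' → (M' : ℕ∞) ≤ Zhang2014.levelIndex W p n' → d'.kolyvaginClass hp.out M' ≠ 0 →
      n₀.primeFactors.card ≤ n'.primeFactors.card := by
    intro n' d' M' hΛ' hM' hM'le hne'
    rw [hcard₀]
    exact Nat.find_min' hex ⟨n', d', M', hΛ', hM', hM'le, hne', rfl⟩
  have hle : n₀.primeFactors.card ≤ n.primeFactors.card :=
    hmin n d M ⟨hsq, hkoly⟩ hM1 hMle hne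
  -- Kolyvagin's structure theorem at the minimiser
  have hstruct := hB W p h5 hsurj K hK h3 h4 hpd hpN hH Dt β ι n₀ d₀ M₀ hΛ₀ hM₀ hM₀le hne₀ hmin
  rcases hstruct with ⟨hc, -, -⟩ | ⟨-, hc, -⟩
  · omega
  · omega

/-- **The known range of the crux, recovered along the Heegner line with NO open input.** Modulo
the named facts {modularity, Hoffstein–Luo, Bump–Friedberg–Hoffstein, Gross–Zagier–Kolyvagin,
`analyticRankEK_eq_add`, Gross–Zagier non-torsion criterion, conductor-`1` reciprocity, BCGS 2026
Thm. 1, Kolyvagin 1991 Thm. 4}, every curve in the crux's range with `ord_{s=1} L(E, s) ≤ 3`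
satisfies `r_an ≤ corank_p Sel_{p^∞}`: run the composition of `selmerRankLB_of_heegnerGap_of_facts`;
in the last branch the non-zero class sits at depth `ν ≥ 1` with `ν + 3 ≤ r_an ≤ 3` — absurd, so
HV is never invoked. This is Jetchev–Lauter–Stein 2009 Cor. 3.5 (i)–(ii) ("Kolyvagin's conjecture
⇒ `r_an` even `> 0 ⇒ r_p ≥ 2`, `r_an` odd `> 1 ⇒ r_p ≥ 3`") made unconditional by BCGS; unlike the
Kato-side `selmerRankLB_of_facts_of_analyticRank_le_three` it uses neither the `p`-parity theorem
nor the corank-1 `p`-converse. CONDITIONAL on the nine named facts; credits nothing.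
[cite: Kolyvagin1991MathAnn, §2 Thm. 4] [cite: BurungaleEtAl2026, Thm. 1 (arXiv:2312.09301 §0.1)] -/
theorem selmerRankLB_of_facts_of_analyticRank_le_three_heegner :
    exists_isNewformOf → HoffsteinLuo1997_exists_twist_L_one_ne_zero →
    bumpFriedbergHoffstein_exists_heegnerField_split_twist_simpleZero →
    rank_eq_analyticRank_of_analyticRank_le_one →
    (∀ (W : WeierstrassCurve ℚ) (K : Type) [Field K] [NumberField K], analyticRankEK_eq_add W K) →
    (∀ (W : WeierstrassCurve ℚ) (N : ℕ) [NeZero N] (K : Type) [Field K] [NumberField K],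
        analyticRankEK_eq_one_iff_heegner_nonTorsion W N K) →
    (∀ (N : ℕ) [NeZero N] (W : WeierstrassCurve ℚ) (K : Type) [Field K] [NumberField K],
        heegnerPointOfConductor_one_galoisConj N W K) →
    BurungaleEtAl2026_exists_kolyvaginClass_ne_zero →
    Kolyvagin1991_selmerCorank_of_kolyvaginClass_ne_zero →
    ∀ (W : WeierstrassCurve ℚ) [W.IsElliptic] [W.IsGloballyMinimal] (p : ℕ) [Fact p.Prime],
      5 ≤ p → W.HasGoodReductionAtPrime p → ¬ (p : ℤ) ∣ W.frobeniusTrace p →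
      W.HasSurjectiveModNGaloisRep p → W.analyticRank ≤ 3 → W.analyticRank ≤ W.selmerCorank p := by
  intro hmod hHL hBFH hGZK hadd hGZ hrec hA hB W _ _ p hp h5 hgood hord hsurj hr3
  by_contra hlt
  push Not at hlt
  haveI : NeZero (W.conductorNorm ℤ) := ⟨(W.conductorNorm_pos_holds).ne'⟩
  obtain ⟨K, iF, iN, hK, h3, h4, hpd, hH, hdo, hps, hr'le, hodd⟩ :=
    stub_heegner_field_supply_of_facts hmod hHL hBFH W p h5 hgood hord hsurj
  have hc' : (W.quadraticTwist (NumberField.discr K : ℚ)).selmerCorank p =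
      (W.quadraticTwist (NumberField.discr K : ℚ)).analyticRank :=
    stub_twist_corank_eq_of_facts hGZK W p h5 hgood hord hsurj K hK h3 h4 hpd hH hr'le
  obtain ⟨Dt, β, ι, n, d, M, hsq, _, _, _, hne, hmax, hpar⟩ :=
    stub_kolyvagin_structure_of_facts hA hB W p h5 hgood hord hsurj K hK h3 h4 hpd hH hdo hps
  have hk : (W.analyticRank + (W.quadraticTwist (NumberField.discr K : ℚ)).analyticRank) % 2 = 1 :=
    Nat.odd_iff.mp hodd
  have hj : (n.primeFactors.card + min (W.selmerCorank p)
      ((W.quadraticTwist (NumberField.discr K : ℚ)).selmerCorank p)) % 2 = 0 :=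
    Nat.even_iff.mp hpar
  rcases Nat.eq_zero_or_pos n.primeFactors.card with hν0 | hν1
  · have hn1 : n = 1 := heegnerGap_eq_one_of_card_primeFactors_eq_zero hsq hν0
    subst hn1
    have h2 : 2 ≤ W.analyticRank + (W.quadraticTwist (NumberField.discr K : ℚ)).analyticRank := by
      rcases le_total (W.selmerCorank p) ((W.quadraticTwist (NumberField.discr K : ℚ)).selmerCorank p)
        with hcc | hcc
      · rw [max_eq_right hcc] at hmax; omega
      · rw [max_eq_left hcc] at hmax; omega
    exact hne (stub_heegner_bottom_torsion_of_facts hadd hGZ hrec W p h5 hgood hord hsurj K hK h3 h4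
      hpd hH h2 Dt β ι d M)
  · rcases le_total (W.selmerCorank p) ((W.quadraticTwist (NumberField.discr K : ℚ)).selmerCorank p)
      with hcc | hcc
    · rw [max_eq_right hcc] at hmax
      omega
    · rw [max_eq_left hcc] at hmax
      rw [min_eq_right hcc] at hj
      -- `ν ≥ 1` and `ν + 3 ≤ r_an ≤ 3`: impossible, HV is not needed
      omega

end Summit.BirchSwinnertonDyer.BirchSwinnertonDyer.Theorems

end
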